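import Summits.BirchSwinnertonDyer.Rank1Residual.O5.HeegnerLogTransportThreeOrdSelmer
import Summits.BirchSwinnertonDyer.Rank1Residual.X11b.BDPRouteSelmerCardBound
import HarnessLib
import HarnessLib.Audit.Tags

/-!
# Heegner-log transport at `p = 3` (KL3), part 8: the consumed direction of KL3-B is a THEOREM at the
# additive prime `3` — `Sel_𝔭(K, W[3^∞]) = 0` from a unit-log point, Kolyvagin's conclusions, Poitou–Tate
# and the local Euler characteristic — o5-r2 GEN 21

HONEST FRAMING (cell `b2b-bsdres`, run/shared/lean/b2b/bsd-rank1-residual/, verbatim in every file): the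
goal of the cell is to DELETE the COMBINATION-SHAPED residual classes of the Birch–Swinnerton-Dyer formula
for ALL analytic-rank `≤ 1` elliptic curves over `ℚ` — "full BSD formula for every rank `≤ 1` curve in
class `C`" assembled STRICTLY from published theorems — so that the rank-`≤ 1` remainder becomes exactly
the CONSTRUCTION-SHAPED classes, which are TYPED (missing-input `Prop`s), NOT attempted. This is not
"finishing BSD". Team O5 (tame potentially supersingular additive `p = 3`, (t′)), planner o5-r2 (the
non-Iwasawa side), GEN 21; RESEARCH ROUTE; THEOREMS ONLY (bookkeeping over explicit hypotheses): no new
node, no Literature fact, no `@[conjecture]`, no new object; NOTHING is booked and no mark of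
`RESIDUAL-MAP.md` moves. O5 OPEN. Memo `HOME/b2b-bsdres-o5-r2/gen21/O5-GEN21.md`.

## What this file proves (GEN 20 docket (b): "KL3-B split … B2 PROVED over the additive local-index API")

The END theorems of the KL3 chain (parts 5–7: `o5_index_unit_of_good_companion_selmer`,
`o5_index_unit_of_ordinary_companion`, and o5-r2 GEN 20's `_residual` forms) consume the typed node KL3-B
`O5BaseSelmerCountThree` (part 1, `O5/HeegnerLogTransportThree.lean`: the anticyclotomic base Selmer COUNT
at the additive prime `3`, "JSW17 Prop. 3.2.1 / Castella (3.2.1)+(calcul) transported to Kodaira III/III*",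
NOT in print) only through `selmerAcBase_card_eq_one_of_units`, i.e. only in the direction

  KL3-B♭: `#Ш(W/K)[3^∞] = 1` and a point `Q ∈ W(K)` of infinite order with `ord₃ log_ω Q = 0` at `ι_𝔭`
          ⟹ `Sel_𝔭(K, W[3^∞]) = 0` (`Nat.card (selmerAcBase (W.baseChange K) 3 𝔭 ∅) = 1`).

THIS DIRECTION NEEDS NO NEW INPUT AT THE ADDITIVE PRIME. It is the `≤` half of JSW17 Prop. 3.2.1, and the
cell's X11b route p2 proved that half ABSTRACTLY IN THE REDUCTION TYPE
(`X11b.SelmerLevelBound.natCard_level_le_of_indices`, `X11b/BDPRouteSelmerLevelBound.lean`: the level-`3^k`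
bound `#H¹_{𝓛^{(k)}}(K, W[3^k]) ≤ L·(S·L)` from the two textbook facts Poitou–Tate (Milne ADT I 4.10(b), the
tree's named fact `poitouTate_sum_localTatePairing_eq_zero K`) and Tate's local Euler characteristic (Milne
ADT I 2.8, `localEulerPoincareCharacteristic (K_𝔮)`), with the three indices `L = [W(K_𝔭) : 3^kW(K_𝔭) + W(K)]`,
`M = [W(K_𝔭) : 3^kW(K_𝔭)] = [W(K) : 3^kW(K)]`, `S ≥ #Ш[3^k]` SYMBOLIC). What is specific to the prime is the
LOCAL INDEX `L`, and at an ADDITIVE `3` the tree already has it: `X11b.LocalIndex.index_range_nsmul_sup_zmultiples_padicPointOf`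
(general reduction type) gives `[W(ℚ₃) : 3^kW(ℚ₃) + ℤR_ι] = 3^{min(k, e_R)}` with
`e_R = ord₃ log_ω R + ord₃ c₃ + ord₃ #W̃_ns(𝔽₃) − 1`, and `#W̃_ns(𝔽₃) = 3` for additive reduction
(`Additive.LocalLog.reductionPointCount_of_addv`), so for `3 ∤ c₃`: **`e_R = ord₃ log_ω R`** (the same
computation as part 4's `padicLogOrd_eq_padicValNat_index_of_logUnit`). A unit-log point `Q` therefore has
`e_Q = 0`; the Mordell–Weil generator `Q₀` (`X11b.RankOne.exists_coord_of_mordellWeilRank_eq_one`,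
`Q = c(Q)•Q₀ + torsion`) has `e_{Q₀} ≤ e_Q` (`X11b.RankOne.exponent_add_padicValNat_le`), so `e_{Q₀} = 0` and
`L = 3^{min(k,0)} = 1` at EVERY level; with `S = #Ш(W/K)[3^∞]` the level bound is `≤ S`, and the passage to
the limit `X11b.LevelKummer.exists_finite_selmerAcBase_natCard_le` gives

  `exists_finite_selmerAcBase_natCard_le_sha_of_logUnit`:  `Sel_𝔭(K, W[3^∞])` finite, `# ≤ #Ш(W/K)[3^∞]`;
  `selmerAcBase_card_eq_one_of_logUnit`:                   `= 1` when `#Ш(W/K)[3^∞] = 1`      (KL3-B♭ PROVED).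

Hypotheses, all in the END theorems' currency: `Addv W 3`; `3 ∤ c₃(W)` (END: `htam` via part 3's
`not_dvd_localTamagawaNumber_of_not_dvd_tamagawaProduct`); `NoLocalThreeTorsionAt W 3` (= `W(ℚ₃)[3] = 0`,
harvest-2 E111 `noLocalThreeTorsionAt_iff_forall_three_nsmul`; it is Castella's (iv) at `p = 3` and gives
`H⁰(K_𝔭, W[3^∞]) = 0`); `K` quadratic; `rank W(K) = 1` and `Ш(W/K)` finite (END: Kolyvagin `hKoW` at the
Heegner point); a degree-one `𝔭 ∣ 3` (so `3` splits: `X11b.splitsIn_primesEquiv_under_iff`); the unit-log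
point `hQW`; and the two textbook facts as DISPLAYED hypotheses `hPT`, `hEP` (named `Prop`s of
`Literature/NumberTheory/GaloisCohomology/PoitouTate.lean` and
`Literature/NumberTheory/GaloisRepresentations/LocalEulerPoincareCharacteristic.lean`, already in the tree,
consumed here exactly as X11b's `p2SelmerCardBoundAt_of_facts` consumes them; NOT new facts).

§2 `selmerAcBase_card_eq_one_of_facts` is the drop-in replacement for part 1's
`selmerAcBase_card_eq_one_of_units hB …` in the END theorems' binder currency (Kolyvagin + Heegner datum +
`htam`); the END re-assemblies with the binder `hB : O5BaseSelmerCountThree` DELETED are part 9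
(`O5/HeegnerLogTransportThreeResidualEndFacts.lean`, same generation). KL3-B itself (the exact COUNT) stays in
the tree as an un-consumed THEOREM-CANDIDATE (its `≥` half needs the converse inclusion of Poitou–Tate and the
exact level count, cf. `X11b/BDPRouteSelmerCountExact.lean` at multiplicative `p`); nothing here asserts it.

NET for the KL3 chain after GEN 21 (memo §3): the W-side base Selmer vanishing at the ADDITIVE prime is no
longer a typed input; part 10 (`O5/HeegnerLogTransportThreeGoodSelmer.lean`, same generation) proves the
companion-side node KL3-G `GoodBaseSelmerCountThree` itself modulo Poitou–Tate duality for Selmer structures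
and the local Euler characteristic. Remaining displayed inputs of the best END
(`o5_index_unit_of_ordinary_companion_facts`, part 9): KL3-A (`KrizLiUnitBitTransportThree`, print: Kriz–Li
Thm. 1.16 / Rem. 1.17) as the ONE typed node, the two textbook facts, the named facts (modularity,
Gross–Zagier, Kolyvagin, Yan–Zhu Thm. 4.15, Wuthrich Lemma 20), the per-row data and the STEP-0 identity.
O5 OPEN; nothing booked; census = EVIDENCE.

References: [JetchevSkinnerWan2017] Prop. 3.2.1 (proof, arXiv:1512.06894 pp. 10–11), (7.1.5) (p. 16);
[Castella2018] proof of Thm. 2.3, (3.2.1)+(calcul) (arXiv:1704.06608 pp. 5–6); [Castella2018Erratum] Thm. 1.1 (iv);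
[MilneADT2006] Ch. I Thm. 4.10(b), Thm. 2.8; [Kolyvagin1990] Thm. A; [GrossLMS1991] §1;
[SilvermanAEC2009] VII.6.1, Exercise 3.7; cell files `X11b/BDPRouteSelmerCardBound.lean` (the template
`p2SelmerCardBoundAt_of_facts`, multiplicative `p`), `X11b/BDPRouteSelmerLevelBound.lean`,
`X11b/BDPRouteLocalIndex.lean`, `O5/HeegnerLogTransportThreeOrdSelmer.lean`.

## Design

No definitions; `noncomputable section`; `open scoped Classical`. Axioms: `propext`, `Classical.choice`,
`Quot.sound`.

## TYPER PLACEMENT NOTE (cc-typer-5 GEN 18 = O5 §3.5 / O6 §3.4 typer of record; by-name ask A-O5-G21-1 of o5-r2 GEN 21, HOME/INBOX.md l.13972: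
'AFTER part 7, place by sha … parts 8, 10a, 10b, 9 — every file ≤ 353 l.')

Source: `HOME/b2b-bsdres-o5-r2/gen21/lean/HeegnerLogTransportThreeBaseSelmer.lean` sha16 `619cf192c609789c` (312 l.; `gen21/SHA16.txt`; o5-r2's `lean check` rc 0 / 0 warnings and joint scratch
`gen21/lean/scratch/scratch_p7_8_10ab_9.lean` b9f2316600933a64 rc 0, axioms of `o5_index_unit_of_ordinary_companion_facts` std), re-hashed by the typer right before writing;
THIS file = KL3 part 8 = the source VERBATIM + this paragraph (imports, module text, every declaration block byte-identical; script `class-closure/typer-5/gen18/g21_place.py`);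
the typer's own joint farm check of parts 7 (R2) + 8 + 10a + 10b + 9 over the tree: rc 0 / 0 warnings, axioms std; DEDUP `lean search --decl` on the new names: no match.
CONTENT LABELS (sources, unchanged): THEOREMS ONLY — 0 `def`, 0 `@[conjecture]`, 0 Literature facts (net named-fact debt 0), no `sorry`; published inputs stay displayed
hypotheses by NAME (`poitouTate_selmerStructure_duality`, `localEulerPoincareCharacteristic`, `gross_zagier`, `kolyvagin`, Yan–Zhu A10, Wuthrich L20, modularity) and the ONE
typed node on the END's path is KL3-A `KrizLiUnitBitTransportThree` (part 1, p340741); KL3-B / KL3-G are NOT re-worded (their consumed directions are PROVED here / in part 10b).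
KL3 parts in the tree: 1–3 p340741 / p341262 / p341640, Global p342632, OrdCompanion p343587 + p344465, OrdSelmer p345030 + p345686, OrdTwist p346273, Residual Engine p347366 +
Residual p348865 (+ End), Literature index lemma p344022.  HONEST FRAMING (cell `b2b-bsdres`): research route, lane CLASS-CLOSURE §3.5 O5; nothing asserted beyond the displayed
binders, nothing booked, no mark of `RESIDUAL-MAP.md` moves; census = EVIDENCE, never a Literature fact; O5 OPEN.
-/

set_option autoImplicit false

noncomputable section

open scoped Classical

open WeierstrassCurve Literature.NumberTheory.EllipticCurves
  Literature.NumberTheory.EllipticCurves.ModularForms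
  Literature.NumberTheory.EllipticCurves.Rank1Residual
  Literature.NumberTheory.EllipticCurves.Rank1Residual.Typed

namespace Summit.BirchSwinnertonDyer.Rank1Residual.O5.HeegnerLogTransport

open Summit.BirchSwinnertonDyer.Rank1Residual.X11b (padicLogOrd embAt padicPointOf SplitsIn
  splitsIn_primesEquiv_under_iff under_eq_ratPlace_of_mem primesEquiv_ratPlace
  finite_and_natCard_selmerGroup_acLevelStructure_zero natCard_sha_inf_torsionBy_le)
open Summit.BirchSwinnertonDyer.Rank1Residual.X11b.LocalIndex (index_range_nsmul_sup_zmultiples_padicPointOf)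
open Literature.NumberTheory.EllipticCurves.Rank1Residual (Addv)
open Summit.BirchSwinnertonDyer.Rank1Residual.Additive.LocalLog (reductionPointCount_of_addv)
open Summit.BirchSwinnertonDyer.Rank1Residual.X11b.AcSelmer (selmerAcBase acLevelStructure
  exists_ringHom_adicCompletion_padic_of_degreeOne noPTorsion_baseChange_adicCompletion_of_padic)
open Literature.NumberTheory.GaloisCohomology (poitouTate_sum_localTatePairing_eq_zero)
open Literature.NumberTheory.GaloisRepresentations (localEulerPoincareCharacteristic)
open IsDedekindDomain (HeightOneSpectrum)
open scoped NumberField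

/-! ## §1 KL3-B♭ proved: `#Sel_𝔭(K, W[3^∞]) ≤ #Ш(W/K)[3^∞]` at the additive prime `3` -/

/-- **`#Sel_𝔭(K, W[3^∞]) ≤ #Ш(W/K)[3^∞]` at an ADDITIVE `3` with `3 ∤ c₃`, `W(ℚ₃)[3] = 0`, `rank W(K) = 1`,
`Ш(W/K)` finite and a point of infinite order with unit `3`-adic logarithm at the degree-one `𝔭 ∣ 3`** — the
`≤` half of JSW17 Prop. 3.2.1 / Castella (3.2.1)+(calcul), read at Kodaira type `I₀*, III, III*`: every level
index `[W(K_𝔭) : 3^kW(K_𝔭) + W(K)]` is `1` (`e = ord₃ log_ω + ord₃ c₃ + ord₃ #W̃_ns(𝔽₃) − 1 = 0`), so the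
abstract level bound (Poitou–Tate + local Euler characteristic, hypotheses `hPT`, `hEP`) is `#Ш[3^∞]` at every
level. CONDITIONAL on the two displayed textbook facts; nothing booked.
[cite: JetchevSkinnerWan2017, Prop. 3.2.1 and (7.1.5) (arXiv:1512.06894 pp. 10–11, 16)]
[cite: Castella2018, proof of Thm. 2.3, (3.2.1) and (calcul) (arXiv:1704.06608 pp. 5–6)]
[cite: MilneADT2006, Ch. I, Thm. 4.10(b) and Thm. 2.8] -/
theorem exists_finite_selmerAcBase_natCard_le_sha_of_logUnit (W : WeierstrassCurve ℚ) [W.IsElliptic]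
    [W.IsGloballyMinimal] (hadd : Addv W 3)
    (hc3 : ¬ 3 ∣ (W.baseChange ℚ_[3]).localTamagawaNumber ℤ_[3]) (ht3 : NoLocalThreeTorsionAt W 3)
    (K : Type) [Field K] [NumberField K] (h2 : Module.finrank ℚ K = 2)
    (hrank : (W.baseChange K).mordellWeilRank = 1) (hfin : Finite (W.baseChange K).sha)
    (𝔭 : HeightOneSpectrum (𝓞 K)) (h𝔭 : ((3 : ℕ) : 𝓞 K) ∈ 𝔭.asIdeal)
    (he : 𝔭.asIdeal.ramificationIdx (𝓞 ℚ) = 1) (hf : 𝔭.asIdeal.inertiaDeg (𝓞 ℚ) = 1)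
    (hQW : ∃ Q : (W.baseChange K).toAffine.Point, ¬ IsOfFinAddOrder Q ∧
      padicLogOrd W 3 (embAt K 3 𝔭 h𝔭 he hf) Q = 0)
    (hPT : poitouTate_sum_localTatePairing_eq_zero K)
    (hEP : ∀ v : HeightOneSpectrum (𝓞 K), localEulerPoincareCharacteristic (v.adicCompletion K)) :
    ∃ _ : Finite (selmerAcBase (W.baseChange K) 3 𝔭 ∅),
      Nat.card (selmerAcBase (W.baseChange K) 3 𝔭 ∅) ≤
        Nat.card (AddCommGroup.primaryComponent (W.baseChange K).sha 3) := by
  -- notation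
  set E := W.baseChange K with hEdef
  set G := W.baseChange ℚ_[3] with hGdef
  haveI hEK : E.IsElliptic := by rw [hEdef, baseChange]; infer_instance
  haveI : Finite E.sha := hfin
  have hp : (3 : ℕ).Prime := Fact.out
  -- (iv) at `p = 3`: `W(ℚ₃)[3] = 0`
  have hiv : ∀ R : G.toAffine.Point, 3 • R = 0 → R = 0 :=
    (noLocalThreeTorsionAt_iff_forall_three_nsmul W 3).mp ht3
  -- `3` splits in the quadratic field `K` (a degree-one prime above it)
  have hsplit : SplitsIn K 3 := by
    have h := (splitsIn_primesEquiv_under_iff h2 𝔭).mpr ⟨he, hf⟩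
    rwa [under_eq_ratPlace_of_mem h𝔭, primesEquiv_ratPlace] at h
  -- the embedding `ι_𝔭 : K → ℚ₃` and `f : W(K) → W(ℚ₃)`
  set ιp := embAt K 3 𝔭 h𝔭 he hf with hιp
  set f : E.toAffine.Point →+ G.toAffine.Point := Affine.Point.map (W' := W) ιp.toRatAlgHom with hfdef
  have hfapply : ∀ x, f x = padicPointOf W 3 ιp x := fun _ => rfl
  have hfinj : Function.Injective f := Affine.Point.map_injective (W' := W) ιp.toRatAlgHom
  have hivK : ∀ x : E.toAffine.Point, 3 • x = 0 → x = 0 := fun x hx => by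
    have h1 : f x = 0 := hiv (f x) (by rw [← map_nsmul, hx, map_zero])
    exact hfinj (by rw [h1, map_zero])
  -- a coordinate `c : W(K) → ℤ` and a generator `Q₀`
  obtain ⟨c, Q₀, hcQ, hcker⟩ := X11b.RankOne.exists_coord_of_mordellWeilRank_eq_one E hrank
  have hA : ∀ a : E.toAffine.Point, IsOfFinAddOrder (a - c a • Q₀) :=
    X11b.RankOne.isOfFinAddOrder_sub_coord_zsmul c Q₀ hcQ hcker
  have hQ₀inf : ¬ IsOfFinAddOrder Q₀ := fun hQ => by
    have h := X11b.RankOne.coord_eq_zero_of_isOfFinAddOrder c hQ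
    rw [hcQ] at h
    exact one_ne_zero h
  have hxinf : ¬ IsOfFinAddOrder (padicPointOf W 3 ιp Q₀) := fun hx =>
    hQ₀inf ((hfinj.isOfFinAddOrder_iff).mp hx)
  -- the unit-log point `Q`
  obtain ⟨Q, hQinf, hQunit⟩ := hQW
  have hyinf : ¬ IsOfFinAddOrder (padicPointOf W 3 ιp Q) := fun hy =>
    hQinf ((hfinj.isOfFinAddOrder_iff).mp hy)
  -- local exponents at the ADDITIVE prime with `3 ∤ c₃`: `e_R = ord₃ log_ω R`
  have hc0 : padicValNat 3 (G.localTamagawaNumber ℤ_[3]) = 0 := padicValNat.eq_zero_of_not_dvd hc3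
  have hns : padicValNat 3 (reductionPointCount W 3) = 1 := by
    rw [reductionPointCount_of_addv W 3 hadd]; simp
  have hexpt : ∀ R : E.toAffine.Point, ¬ IsOfFinAddOrder (padicPointOf W 3 ιp R) →
      ∃ e : ℕ, (∀ k, ((nsmulAddMonoidHom (3 ^ k) : G.toAffine.Point →+ _).range ⊔
        AddSubgroup.zmultiples (padicPointOf W 3 ιp R)).index = 3 ^ min k e) ∧
        (e : ℤ) = padicLogOrd W 3 ιp R := by
    intro R hR
    obtain ⟨e, -, he0⟩ := index_range_nsmul_sup_zmultiples_padicPointOf W 3 hiv ιp R hR 0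
    rw [hc0, hns] at he0
    simp only [Nat.cast_zero, Nat.cast_one, add_zero, add_sub_cancel_right] at he0
    refine ⟨e, fun k => ?_, he0⟩
    obtain ⟨e', h1, h2'⟩ := index_range_nsmul_sup_zmultiples_padicPointOf W 3 hiv ιp R hR k
    rw [hc0, hns] at h2'
    simp only [Nat.cast_zero, Nat.cast_one, add_zero, add_sub_cancel_right] at h2'
    have : e' = e := by exact_mod_cast h2'.trans he0.symm
    rw [h1, this]
  obtain ⟨eQ₀, heQ₀k, -⟩ := hexpt Q₀ hxinf
  obtain ⟨eQ, heQk, heQ⟩ := hexpt Q hyinf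
  -- `e_Q = 0` (unit log) and `e_{Q₀} ≤ e_Q` (`Q = c(Q)•Q₀ + torsion`), so `e_{Q₀} = 0`
  have heQ0 : eQ = 0 := by
    rw [hQunit] at heQ
    exact_mod_cast heQ
  have hyx : padicPointOf W 3 ιp Q = c Q • padicPointOf W 3 ιp Q₀ + f (Q - c Q • Q₀) := by
    rw [← hfapply, ← hfapply, map_sub, map_zsmul]; abel
  have hexp : eQ₀ + padicValNat 3 (c Q).natAbs ≤ eQ :=
    X11b.RankOne.exponent_add_padicValNat_le G hiv hxinf (f.isOfFinAddOrder (hA Q)) hyx heQ₀k heQk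
  have heQ₀0 : eQ₀ = 0 := by omega
  -- the two primes above `3` and the (iv)-vanishing `H⁰(K_𝔭, W[3^∞]) = 0`
  obtain ⟨σ, 𝔮, hσ, -, -, hall⟩ := X11b.LocalIndexTransport.exists_conj_prime_of_splitsIn K 3 h2 hsplit h𝔭
  have h𝔮 : ∀ v : HeightOneSpectrum (𝓞 K), v ≠ 𝔭 → ((3 : ℕ) : 𝓞 K) ∈ v.asIdeal → v = 𝔮 :=
    fun v hv hpv => (hall v hpv).resolve_left hv
  obtain ⟨eKp⟩ := exists_ringHom_adicCompletion_padic_of_degreeOne 3 𝔭 h𝔭 he hf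
  have hKv := noPTorsion_baseChange_adicCompletion_of_padic W 3 𝔭 eKp hiv
  have hΓ := X11b.LocalIndexTransport.eq_zero_of_forall_restrictField_eq E 3 𝔭 hKv
  -- `S = #Ш[3^∞] ≥ 1`
  set S := Nat.card (AddCommGroup.primaryComponent E.sha 3) with hSdef
  obtain ⟨v, hv⟩ : ∃ v : ℕ, S = 3 ^ v := X11b.exists_natCard_primaryComponent_eq_pow 3
  have hS1 : 1 ≤ S := by rw [hv]; exact Nat.one_le_pow _ _ hp.pos
  -- THE LEVEL BOUNDS: `#H¹_{𝓛^{(k)}}(K, W[3^k]) ≤ 1 · (S · 1)`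
  have hlevel : ∀ k, Finite (acLevelStructure E 3 k 𝔭 ∅).selmerGroup ∧
      Nat.card (acLevelStructure E 3 k 𝔭 ∅).selmerGroup ≤ S := by
    intro k
    rcases Nat.eq_zero_or_pos k with rfl | hk
    · obtain ⟨hfin0, hle⟩ := finite_and_natCard_selmerGroup_acLevelStructure_zero E 3 𝔭 ∅
      exact ⟨hfin0, hle.trans hS1⟩
    · -- the three indices at level `k`: `L = 1`, `M = N = 3^k`
      have hL : ((Affine.Point.baseChange (W' := W.baseChange K) K (𝔭.adicCompletion K)).range ⊔
          (zsmulAddGroupHom ((3 ^ k : ℕ) : ℤ) :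
            ((W.baseChange K).baseChange (𝔭.adicCompletion K)).toAffine.Point →+ _).range).index =
          1 := by
        rw [X11b.LocalIndexTransport.index_range_baseChange_sup_eq_padic K 3 𝔭 h𝔭 he hf W,
          X11b.RankOne.range_zsmulAddGroupHom_natCast, sup_comm]
        change ((nsmulAddMonoidHom (3 ^ k) : G.toAffine.Point →+ _).range ⊔ f.range).index = _
        rw [X11b.RankOne.range_nsmul_sup_range_eq G f c Q₀ hA k hiv, hfapply, heQ₀k k, heQ₀0,
          Nat.min_zero, pow_zero]
      have hM : ((zsmulAddGroupHom ((3 ^ k : ℕ) : ℤ) :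
          ((W.baseChange K).baseChange (𝔭.adicCompletion K)).toAffine.Point →+ _).range).index =
          3 ^ k := by
        rw [X11b.LocalIndexTransport.index_range_zsmul_eq_padic K 3 𝔭 h𝔭 he hf W,
          X11b.RankOne.range_zsmulAddGroupHom_natCast]
        exact X11b.RankOne.index_range_nsmul_pow_padic G hiv _ hxinf k
      have hN : ((zsmulAddGroupHom ((3 ^ k : ℕ) : ℤ) : E.toAffine.Point →+ _).range).index =
          3 ^ k := X11b.RankOne.index_range_zsmul_pow_eq c Q₀ hcQ hcker hivK k
      obtain ⟨hfink, hle⟩ := X11b.SelmerLevelBound.natCard_level_le_of_indices W K 3 k 𝔭 𝔮 hk σ hσ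
        h𝔮 hΓ hPT (hEP 𝔮) hL hM (pow_ne_zero _ hp.ne_zero) hN (natCard_sha_inf_torsionBy_le E 3 k)
      refine ⟨hfink, hle.trans ?_⟩
      rw [one_mul, mul_one]
  -- pass to the limit `Sel_𝔭(K, W[3^∞]) = lim_k`
  obtain ⟨hfinSel, hcard⟩ := X11b.LevelKummer.exists_finite_selmerAcBase_natCard_le E 3 𝔭 ∅
    E.zsmul_geomPoints_surjective_holds S (fun k => (hlevel k).1) (fun k => (hlevel k).2)
  exact ⟨hfinSel, hcard⟩

/-- **KL3-B♭ PROVED: `Sel_𝔭(K, W[3^∞]) = 0` at the additive prime `3`** from `#Ш(W/K)[3^∞] = 1` and a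
unit-log point of infinite order (plus `3 ∤ c₃`, `W(ℚ₃)[3] = 0`, `rank W(K) = 1`, `Ш(W/K)` finite, `K`
quadratic, `𝔭 ∣ 3` of degree one), CONDITIONAL on the displayed textbook facts `hPT` (Poitou–Tate, Milne
ADT I 4.10(b)) and `hEP` (local Euler characteristic, Milne ADT I 2.8). This is exactly the direction in
which the END theorems of parts 5–7 consume the typed node KL3-B `O5BaseSelmerCountThree`
(`selmerAcBase_card_eq_one_of_units`); the node itself (the exact count) is NOT asserted. Nothing booked.
[cite: JetchevSkinnerWan2017, Prop. 3.2.1 and (7.1.5) (arXiv:1512.06894 pp. 10–11, 16)]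
[cite: Castella2018, proof of Thm. 2.3, (3.2.1) and (calcul) (arXiv:1704.06608 pp. 5–6)]
[cite: MilneADT2006, Ch. I, Thm. 4.10(b) and Thm. 2.8] -/
theorem selmerAcBase_card_eq_one_of_logUnit (W : WeierstrassCurve ℚ) [W.IsElliptic]
    [W.IsGloballyMinimal] (hadd : Addv W 3)
    (hc3 : ¬ 3 ∣ (W.baseChange ℚ_[3]).localTamagawaNumber ℤ_[3]) (ht3 : NoLocalThreeTorsionAt W 3)
    (K : Type) [Field K] [NumberField K] (h2 : Module.finrank ℚ K = 2)
    (hrank : (W.baseChange K).mordellWeilRank = 1) (hfin : Finite (W.baseChange K).sha)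
    (hsha : Nat.card (AddCommGroup.primaryComponent (W.baseChange K).sha 3) = 1)
    (𝔭 : HeightOneSpectrum (𝓞 K)) (h𝔭 : ((3 : ℕ) : 𝓞 K) ∈ 𝔭.asIdeal)
    (he : 𝔭.asIdeal.ramificationIdx (𝓞 ℚ) = 1) (hf : 𝔭.asIdeal.inertiaDeg (𝓞 ℚ) = 1)
    (hQW : ∃ Q : (W.baseChange K).toAffine.Point, ¬ IsOfFinAddOrder Q ∧
      padicLogOrd W 3 (embAt K 3 𝔭 h𝔭 he hf) Q = 0)
    (hPT : poitouTate_sum_localTatePairing_eq_zero K)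
    (hEP : ∀ v : HeightOneSpectrum (𝓞 K), localEulerPoincareCharacteristic (v.adicCompletion K)) :
    Nat.card (selmerAcBase (W.baseChange K) 3 𝔭 ∅) = 1 := by
  obtain ⟨hfinSel, hle⟩ := exists_finite_selmerAcBase_natCard_le_sha_of_logUnit W hadd hc3 ht3 K h2
    hrank hfin 𝔭 h𝔭 he hf hQW hPT hEP
  rw [hsha] at hle
  haveI := hfinSel
  have hpos : 0 < Nat.card (selmerAcBase (W.baseChange K) 3 𝔭 ∅) := Nat.card_pos
  omega

/-! ## §2 The drop-in form in the END theorems' currency (Kolyvagin at the Heegner point, `htam`) -/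

/-- **KL3-B♭ in the END theorems' binder currency**: the statement of part 1's
`selmerAcBase_card_eq_one_of_units` with the binder `h : O5BaseSelmerCountThree` REPLACED by the two
textbook facts `hPT`, `hEP` (and Kolyvagin's theorem `hKo : kolyvagin N W K` at the non-torsion Heegner point,
`3 ∤ ∏ c_ℓ(W)`, which every END already carries; the unused binders `hj`, `hf₂`, `hs`, `hd`, `hlog` of the
original are dropped). Used by part 9 to delete `hB` from the END theorems. CONDITIONAL on the displayed
hypotheses; nothing booked. [cite: JetchevSkinnerWan2017, Prop. 3.2.1 (arXiv:1512.06894 pp. 10–11)]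
[cite: MilneADT2006, Ch. I, Thm. 4.10(b) and Thm. 2.8] [cite: Kolyvagin1990, Thm. A] -/
theorem selmerAcBase_card_eq_one_of_facts
    (hPT : ∀ (K : Type) [Field K] [NumberField K], poitouTate_sum_localTatePairing_eq_zero K)
    (hEP : ∀ (K : Type) [Field K] [NumberField K] (v : HeightOneSpectrum (𝓞 K)),
      localEulerPoincareCharacteristic (v.adicCompletion K))
    (W : WeierstrassCurve ℚ) [W.IsElliptic] [W.IsGloballyMinimal] (hA : Addv W 3)
    (htam : ¬ 3 ∣ W.tamagawaProduct) (ht : NoLocalThreeTorsionAt W 3)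
    {N : ℕ} [NeZero N] (D : ModularParametrizationData W N) (K : Type) [Field K] [NumberField K]
    (hK : IsImaginaryQuadratic K) (hH : SatisfiesHeegnerHypothesis N K) (hKo : kolyvagin N W K)
    (H : HeegnerDatum N (NumberField.discr K)) (ι : K →+* ℂ) (P : (W.baseChange K).toAffine.Point)
    (hP : WeierstrassCurve.Affine.Point.map ι.toRatAlgHom P = heegnerPointComplex D H)
    (hP' : ¬ IsOfFinAddOrder P) (𝔭 : HeightOneSpectrum (𝓞 K)) (h𝔭 : ((3 : ℕ) : 𝓞 K) ∈ 𝔭.asIdeal)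
    (he : 𝔭.asIdeal.ramificationIdx (𝓞 ℚ) = 1) (hf : 𝔭.asIdeal.inertiaDeg (𝓞 ℚ) = 1)
    (hSha : Nat.card (AddCommGroup.primaryComponent (W.baseChange K).sha 3) = 1)
    (hQW : ∃ Q : (W.baseChange K).toAffine.Point, ¬ IsOfFinAddOrder Q ∧
      padicLogOrd W 3 (embAt K 3 𝔭 h𝔭 he hf) Q = 0) :
    Nat.card (selmerAcBase (W.baseChange K) 3 𝔭 ∅) = 1 := by
  obtain ⟨hrank, hfin⟩ := hKo hK hH ⟨D, H, ι, hP⟩ hP'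
  exact selmerAcBase_card_eq_one_of_logUnit W hA
    (not_dvd_localTamagawaNumber_of_not_dvd_tamagawaProduct W htam) ht K hK.1 hrank hfin hSha 𝔭 h𝔭 he
    hf hQW (hPT K) (hEP K)

end Summit.BirchSwinnertonDyer.Rank1Residual.O5.HeegnerLogTransport

end
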